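import Summits.CriticalPhenomena.PercolationContinuityZ3.Theorems.Transplant.CayleySkeletonNoFC
import Summits.CriticalPhenomena.PercolationContinuityZ3.Theorems.Transplant.SkeletonKernelGenerators
import HarnessLib

/-!
# `θ(p_c) = 0` for nilpotent groups from two sign automorphisms of a generating set (the INPUT of record for nilpotent Cayley graphs)

builds on p205010 (kernel theorem, internal audit signed; external expert review pending).
Lane `prim-bschramm`, seat `prim-bschramm-p4` gen 10 (PART C3 of `P4-GENERAL.md`, §30.3 made kernel).  Helper file
(`--supports stmt-CriticalPhenomena-4575 --as helper`).

INPUT (`NilSigns.SignData Γ`): a group `Γ` of nilpotency class `≤ c + 1`, a finite symmetric generating set `A`, an additive `φ : Γ → ℤ²` and two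
letters `x, y ∈ A` with `φ x = e₀`, `φ y = e₁`, every other letter in `ker φ ∪ {x⁻¹, y⁻¹}`, and two automorphisms `ν, κ` of `Γ` permuting `A` with
`φν = −φ`, `φκ = diag(1,−1)φ`.  OUTPUT: for the finite generating system `S = A ∪ {left-normed commutators of letters of weights 2 … c+1}`,
**`θ_g(p_c) = 0` at every vertex of `Cay(Γ; S)`** (`SignData.criticalContinuity`).  The kernel criterion of `CayleySign₀` is supplied by
`KerGen.mem_closure_of_eq_zero` (file `SkeletonKernelGenerators`); `ν, κ` preserve `S` because a homomorphism maps left-normed commutators of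
letters to left-normed commutators of the images (`KerGen.image_W`).  Customers: the free nilpotent groups (file `CayleyFreeNilpotentClass`),
their products with any f.g. nilpotent group, the higher Heisenberg groups, sign-respecting central quotients.
-/

namespace Summit.CriticalPhenomena.PercolationContinuityZ3.Theorems.Transplant

namespace NilSigns

open SimpleGraph Subgroup Literature.Probability.LatticeModels Literature.Probability.Percolation
open scoped commutatorElement

/-- **The input: a nilpotent group with a signed rank-2 letter quotient.** [cite: KozmaNitzan2024, §4 p. 16 (Lemma 8)] -/
structure SignData (Γ : Type) [Group Γ] where
  /-- the letters -/
  A : Finset Γ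
  /-- the letters are symmetric -/
  symm : ∀ a ∈ A, a⁻¹ ∈ A
  /-- the letters generate -/
  gen : Subgroup.closure (A : Set Γ) = ⊤
  /-- the class bound: `Γ` has class `≤ c + 1` -/
  c : ℕ
  /-- nilpotency -/
  nil : (⊤ : Subgroup Γ).lowerCentralSeries (c + 1) = ⊥
  /-- the skeleton -/
  φ : Γ → Site 2
  /-- additivity -/
  map_mul : ∀ g h : Γ, φ (g * h) = φ g + φ h
  /-- the first distinguished letter -/
  x : Γ
  /-- it is a letter -/
  x_mem : x ∈ A
  /-- its height -/
  φ_x : φ x = Pi.single 0 1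
  /-- the second distinguished letter -/
  y : Γ
  /-- it is a letter -/
  y_mem : y ∈ A
  /-- its height -/
  φ_y : φ y = Pi.single 1 1
  /-- every letter is in the kernel or among `x^{±1}, y^{±1}` -/
  letters : ∀ a ∈ A, φ a = 0 ∨ a = x ∨ a = x⁻¹ ∨ a = y ∨ a = y⁻¹
  /-- the reversing automorphism -/
  ν : Γ ≃* Γ
  /-- `ν` permutes the letters -/
  ν_mem : ∀ a, ν a ∈ A ↔ a ∈ A
  /-- `φν = −φ` -/
  ν_φ : ∀ g, φ (ν g) = -φ g
  /-- the axis flip -/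
  κ : Γ ≃* Γ
  /-- `κ` permutes the letters -/
  κ_mem : ∀ a, κ a ∈ A ↔ a ∈ A
  /-- `φκ = diag(1,−1)φ` -/
  κ_φ : ∀ g, φ (κ g) = flipSnd (φ g)

namespace SignData

variable {Γ : Type} [Group Γ] (D : SignData Γ)

/-- The left-normed commutators of letters of each weight form a finite set. [folklore] -/
theorem W_finite (k : ℕ) : (KerGen.W (D.A : Set Γ) k).Finite := by
  induction k with
  | zero => exact D.A.finite_toSet
  | succ k ih => rw [KerGen.W_succ]; exact Set.Finite.image2 _ D.A.finite_toSet ih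

/-- The generating system as a set: letters and left-normed commutators of weights `2 … c + 1`. [folklore] -/
def SS : Set Γ := (D.A : Set Γ) ∪ ⋃ k ∈ Finset.range D.c, KerGen.W (D.A : Set Γ) (k + 1)

/-- It is finite. [folklore] -/
theorem SS_finite : D.SS.Finite :=
  Set.Finite.union D.A.finite_toSet (Set.Finite.biUnion (Finset.range D.c).finite_toSet fun k _ => D.W_finite (k + 1))

/-- **THE GENERATING SYSTEM `S`** (a `Finset`). [folklore] -/
noncomputable def S : Finset Γ := D.SS_finite.toFinset

/-- Membership in `S`. [folklore] -/
theorem mem_S {s : Γ} : s ∈ D.S ↔ s ∈ D.A ∨ ∃ k < D.c, s ∈ KerGen.W (D.A : Set Γ) (k + 1) := by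
  rw [S, Set.Finite.mem_toFinset, SS, Set.mem_union, Finset.mem_coe, Set.mem_iUnion₂]
  simp only [Finset.mem_range, exists_prop]

/-- `φ` vanishes on left-normed commutators of weight `≥ 2`. [folklore] -/
theorem φ_W_succ {k : ℕ} {w : Γ} (hw : w ∈ KerGen.W (D.A : Set Γ) (k + 1)) : D.φ w = 0 := by
  obtain ⟨a, -, w', -, rfl⟩ := hw
  exact KerGen.phi_commutatorElement D.φ D.map_mul a w'

/-- **Heights of the generators have sup-norm `≤ 1`.** [folklore] -/
theorem lip_S (s : Γ) (hs : s ∈ D.S) (j : Fin 2) : |D.φ s j| ≤ 1 := by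
  rcases D.mem_S.1 hs with h | ⟨k, -, hk⟩
  · rcases D.letters s h with h0 | rfl | rfl | rfl | rfl
    · rw [h0]; simp
    · rw [D.φ_x]; fin_cases j <;> simp
    · rw [KerGen.phi_inv D.φ D.map_mul, D.φ_x]; fin_cases j <;> simp
    · rw [D.φ_y]; fin_cases j <;> simp
    · rw [KerGen.phi_inv D.φ D.map_mul, D.φ_y]; fin_cases j <;> simp
  · rw [D.φ_W_succ hk]; simp

/-- An automorphism permuting the letters preserves `S`. [folklore] -/
theorem map_mem_S (e : Γ ≃* Γ) (he : ∀ a, e a ∈ D.A ↔ a ∈ D.A) {s : Γ} (hs : s ∈ D.S) : e s ∈ D.S := by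
  have hA : (e : Γ →* Γ) '' (D.A : Set Γ) = D.A := by
    ext a
    simp only [Set.mem_image, Finset.mem_coe, MonoidHom.coe_coe]
    constructor
    · rintro ⟨b, hb, rfl⟩; exact (he b).2 hb
    · intro ha; exact ⟨e.symm a, (he _).1 (by simpa using ha), by simp⟩
  rcases D.mem_S.1 hs with h | ⟨k, hk, h⟩
  · exact D.mem_S.2 (Or.inl ((he s).2 h))
  · refine D.mem_S.2 (Or.inr ⟨k, hk, ?_⟩)
    rw [← hA, ← KerGen.image_W]
    exact ⟨s, h, rfl⟩

/-- An automorphism permuting the letters permutes `S`. [folklore] -/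
theorem map_mem_S_iff (e : Γ ≃* Γ) (he : ∀ a, e a ∈ D.A ↔ a ∈ D.A) (s : Γ) : e s ∈ D.S ↔ s ∈ D.S := by
  refine ⟨fun h => ?_, D.map_mem_S e he⟩
  have he' : ∀ a, e.symm a ∈ D.A ↔ a ∈ D.A := fun a => by rw [← he (e.symm a), MulEquiv.apply_symm_apply]
  simpa using D.map_mem_S e.symm he' h

/-- **THE KERNEL CRITERION**: `ker φ` is generated by the generators of height `0`. [folklore] -/
theorem ker_gen (g : Γ) (hg : D.φ g = 0) : g ∈ Subgroup.closure (↑(D.S.filter fun s => D.φ s = 0) : Set Γ) := by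
  have h := KerGen.mem_closure_of_eq_zero (A := (D.A : Set Γ)) D.φ D.map_mul D.gen (fun a ha => D.symm a ha) D.φ_x D.φ_y
    (fun a ha => D.letters a ha) hg
  refine (Subgroup.closure_le _).2 ?_ h
  rintro t (⟨ht, ht0⟩ | ht)
  · exact Subgroup.subset_closure (Finset.mem_coe.2 (Finset.mem_filter.2 ⟨D.mem_S.2 (Or.inl ht), ht0⟩))
  · obtain ⟨k, hk⟩ := Set.mem_iUnion.1 ht
    by_cases hkc : k < D.c
    · exact Subgroup.subset_closure (Finset.mem_coe.2 (Finset.mem_filter.2 ⟨D.mem_S.2 (Or.inr ⟨k, hkc, hk⟩), D.φ_W_succ hk⟩))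
    · have h1 : t = 1 := KerGen.W_eq_one_of_lowerCentralSeries_eq_bot D.nil (by omega) hk
      rw [SetLike.mem_coe, h1]; exact Subgroup.one_mem _

/-- **THE `CayleySign₀` DATUM of `Cay(Γ; S)`.** [cite: KozmaNitzan2024, §4 p. 16 (Lemma 8)] [cite: BenjaminiSchramm1996, §2] -/
noncomputable def cayleySign₀ : CayleySign₀ Γ D.S where
  φ := D.φ
  map_mul := D.map_mul
  lip := D.lip_S
  step := fun j => by
    fin_cases j
    · exact ⟨D.x, D.mem_S.2 (Or.inl D.x_mem), D.φ_x⟩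
    · exact ⟨D.y, D.mem_S.2 (Or.inl D.y_mem), D.φ_y⟩
  ν := D.ν
  ν_mem := D.map_mem_S_iff D.ν D.ν_mem
  ν_φ := D.ν_φ
  ker_gen := D.ker_gen
  κ := D.κ
  κ_mem := D.map_mem_S_iff D.κ D.κ_mem
  κ_φ := D.κ_φ

/-- **THEOREM: `θ_g(p_c) = 0` at every vertex of `Cay(Γ; S)` for every nilpotent group `Γ` with a signed rank-2 letter quotient** (`SignData`),
`S` = letters and left-normed commutators of letters of weights `≤` class.  No finite-conjugacy element, no growth computation, no geometry: the
INPUT is two automorphisms of a generating set.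
builds on p205010 (kernel theorem, internal audit signed; external expert review pending).
[cite: BenjaminiSchramm1996, Conj. 4] [cite: AizenmanGrimmett1991, Thm 1] [cite: KozmaNitzan2024, §1 p. 2 (approach 1)] -/
theorem criticalContinuity (g : Γ) : theta (mulCayley (↑D.S : Set Γ)) g (criticalProbIOf (mulCayley (↑D.S : Set Γ)) g) = 0 :=
  D.cayleySign₀.criticalContinuity g

end SignData

end NilSigns

end Summit.CriticalPhenomena.PercolationContinuityZ3.Theorems.Transplant
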